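import Summits.Ventures.PercRepro.GenQSolidPlaneCount
import Summits.Ventures.PercRepro.GenQSolidDemandFree
import Summits.Ventures.PercRepro.GenQFlatFacts
import Summits.Ventures.PercRepro.GenQFlatLatticeA
import Summits.Ventures.PercRepro.GenQHyperplaneRowsB

/-!
# PercRepro — the flat-lattice counting rows, part G: the cap on the `5`-subsets at rank `6` (night-4, gen 11)

The `5`-subsets of a rank-`6` set `G` have rank `5` (`Σ_s SP_{s,5}`, the bases of the rank-`5` traces), rank `4`
(inside one solid each: `≥ r₅(|F ∩ G|)` per solid, the lane's `card_rank_four_fives_ge`), or rank `3` (inside one plane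
each: all `C(|P ∩ G|, 5)` of them, lines having `≤ 3` points), so

`Σ_s SP_{s,5} + Σ_s r₅(s)·NR 4 s + Σ_s C(s, 5)·NR 3 s ≤ C(n, 5)`   (`gd5_row`)

— the row (G-D) of the two-level profile LP at `q = 6`, `j = 5` (sheet §65 (b)); the `j = 6` / `q = 7` instances need the
tables `r₆`, `ρ` and are not typed.  Imports `GenQSolidPlaneCount`, `GenQSolidDemandFree`, `GenQFlatFacts`,
`GenQFlatLatticeA`, `GenQHyperplaneRowsB`.
-/
namespace PercRepro.Night4

open Finset ThmH SixFour GenQ PerFlat Star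

variable {α : Type*} [DecidableEq α] {M : Matroid α} [M.Finite]

/-- A `5`-subset of a plane trace has rank exactly `3` when lines have `≤ 3` points. -/
theorem eRk_eq_three_of_subset_plane (hs : Simple M) (hline : ∀ L ∈ flatsQ M 2, L.card ≤ 3)
    {G P A : Finset α} (hG : G ⊆ gr M) (hP : P ∈ flatsQ M 3) (hA : A ⊆ P ∩ G) (hA5 : A.card = 5) :
    M.eRk (A : Set α) = ((3 : ℕ) : ℕ∞) := by
  have hP' := mem_flatsQ.1 hP
  have hAG : A ⊆ G := hA.trans Finset.inter_subset_right
  have hle : M.eRk (A : Set α) ≤ ((3 : ℕ) : ℕ∞) := by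
    rw [← hP'.2.2]
    exact M.eRk_mono (Finset.coe_subset.2 (hA.trans Finset.inter_subset_left))
  obtain ⟨a, ha⟩ := exists_eRk_eq_nat (M := M) A
  rw [ha] at hle ⊢
  have ha3 : a ≤ 3 := by exact_mod_cast hle
  by_contra hne
  have ha2 : a ≤ 2 := by
    rcases Nat.lt_or_ge a 3 with h | h
    · omega
    · exfalso; exact hne (by rw [show a = 3 by omega])
  -- `A` lies in the flat `cl A` of rank `a ≤ 2`, which has `≤ 3` points (`≤ 1` if `a ≤ 1`)
  have hflat : clF M A ∈ flatsQ M a := by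
    rw [mem_flatsQ, ← Finset.coe_subset, coe_clF, coe_gr]
    exact ⟨M.closure_subset_ground _, M.isFlat_closure _, by rw [M.eRk_closure_eq, ha]⟩
  have hAcl : A ⊆ clF M A := by
    intro y hy
    rw [mem_clF]
    refine M.subset_closure _ ?_ (Finset.mem_coe.2 hy)
    rw [← coe_gr M]
    exact Finset.coe_subset.2 (hAG.trans hG)
  have hcard := Finset.card_le_card hAcl
  rcases Nat.lt_or_ge a 2 with h1 | h2
  · have := card_le_one_of_flatsQ_le_one hs (by omega : a ≤ 1) hflat
    omega
  · have ha2' : a = 2 := by omega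
    rw [ha2'] at hflat
    have := hline _ hflat
    omega

/-- **(G-D) at `q = 6`, `j = 5`**: `Σ_s SP_{s,5} + Σ_s r₅(s)·NR 4 s + Σ_s C(s, 5)·NR 3 s ≤ C(n, 5)`. -/
theorem gd5_row (hs : Simple M) (hline : ∀ L ∈ flatsQ M 2, L.card ≤ 3) (hplane : ∀ P ∈ flatsQ M 3, P.card ≤ 6)
    {G : Finset α} (hG : G ⊆ gr M) (hrG : M.eRk (G : Set α) = ((6 : ℕ) : ℕ∞)) :
    ∑ s ∈ Finset.range (G.card + 1), spSum M G 5 s 5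
      + ∑ s ∈ Finset.range (G.card + 1), r5 s * NR M G 4 s
      + ∑ s ∈ Finset.range (G.card + 1), s.choose 5 * NR M G 3 s ≤ G.card.choose 5 := by
  classical
  rw [choose_eq_sum_card_rank_subsets hrG 5]
  -- the three ranks `5`, `4`, `3` among `ρ ≤ 6`
  have hsplit : ∑ ρ ∈ Finset.range (6 + 1),
      ((G.powersetCard 5).filter (fun T : Finset α => M.eRk (T : Set α) = (ρ : ℕ∞))).card
      ≥ ((G.powersetCard 5).filter (fun T : Finset α => M.eRk (T : Set α) = ((5 : ℕ) : ℕ∞))).card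
        + ((G.powersetCard 5).filter (fun T : Finset α => M.eRk (T : Set α) = ((4 : ℕ) : ℕ∞))).card
        + ((G.powersetCard 5).filter (fun T : Finset α => M.eRk (T : Set α) = ((3 : ℕ) : ℕ∞))).card := by
    simp only [Finset.sum_range_succ, Finset.sum_range_zero]
    push_cast
    omega
  refine le_trans ?_ hsplit
  refine Nat.add_le_add (Nat.add_le_add ?_ ?_) ?_
  · rw [h2_row hG 5 5]
  · -- rank `4`: one solid each, `≥ r₅` per solid
    rw [card_rank_eq_eq_sum_flats hG 5 4]
    have hfib : ∑ s ∈ Finset.range (G.card + 1), r5 s * NR M G 4 s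
        = ∑ F ∈ flatsQ M 4, r5 (F ∩ G).card := by
      unfold NR
      rw [← Finset.sum_fiberwise_of_maps_to (s := flatsQ M 4) (t := Finset.range (G.card + 1))
        (g := fun F : Finset α => (F ∩ G).card) (fun F _ => Finset.mem_coe.2 (Finset.mem_range.2
          (Nat.lt_succ_of_le (Finset.card_le_card Finset.inter_subset_right))))]
      refine Finset.sum_congr rfl (fun s _ => ?_)
      rw [Finset.card_eq_sum_ones, Finset.mul_sum, mul_one]
      refine Finset.sum_congr rfl (fun F hF => ?_)
      rw [(Finset.mem_filter.1 hF).2]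
    rw [hfib]
    exact Finset.sum_le_sum (fun F hF => card_rank_four_fives_ge hs hline hplane hG hF)
  · -- rank `3`: one plane each, all `C(s, 5)` of them
    rw [card_rank_eq_eq_sum_flats hG 5 3]
    have hfib : ∑ s ∈ Finset.range (G.card + 1), s.choose 5 * NR M G 3 s
        = ∑ P ∈ flatsQ M 3, (P ∩ G).card.choose 5 := by
      unfold NR
      rw [← Finset.sum_fiberwise_of_maps_to (s := flatsQ M 3) (t := Finset.range (G.card + 1))
        (g := fun P : Finset α => (P ∩ G).card) (fun P _ => Finset.mem_coe.2 (Finset.mem_range.2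
          (Nat.lt_succ_of_le (Finset.card_le_card Finset.inter_subset_right))))]
      refine Finset.sum_congr rfl (fun s _ => ?_)
      rw [Finset.card_eq_sum_ones, Finset.mul_sum, mul_one]
      refine Finset.sum_congr rfl (fun P hP => ?_)
      rw [(Finset.mem_filter.1 hP).2]
    rw [hfib]
    refine Finset.sum_le_sum (fun P hP => ?_)
    rw [← Finset.card_powersetCard]
    refine le_of_eq ?_
    symm
    rw [Finset.card_filter_eq_iff]
    intro A hA
    rw [Finset.mem_powersetCard] at hA
    exact eRk_eq_three_of_subset_plane hs hline hG hP hA.1 hA.2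

end PercRepro.Night4
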